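import Mathlib
import Summits.Ventures.PercRepro2.HCov
import Summits.Ventures.PercRepro2.ZMeanEvents
import Summits.Ventures.PercRepro2.RootLeafOCells

set_option synthInstance.maxSize 2048

/-!
# A ROOT as a leaf at an UNMARKED vertex `u`, part 1: the 35 cells of the pattern of
`(o, a₂, c, b, u)` (blind cell PercRepro2, p4 g3; S3 (G4-u), proofs/subclaims/S3-CLASSES.md §S3.10)

Every mass of the root-leaf cubic in either world of the leaf edge is the probability of an event
of `G − a₁` that depends only on the seven connections `u ↔ a₂`, `a₂ ↔ o`, `u ↔ o`, `a₂ ↔ c`,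
`u ↔ c`, `a₂ ↔ b`, `u ↔ b` (`stateVec`); by transitivity only 35 joint states occur
(`consistent`: when `u ↔ a₂` the two sides coincide, otherwise no vertex is on both).  The
first-coefficient identity of (G4-u) is a polynomial identity in the 35 cell masses
`prob (cell v)`; this file proves the additivity `prob M = ∑_{v ∈ consistent, φ v} prob (cell v)`
for every event `M` whose membership is a Boolean function `φ` of the state vector
(`prob_eq_sum_cells`), exactly as `RootLeafOCells` does with thirteen cells.
-/

namespace Summit.Ventures.PercRepro2

open UnionCluster CovForm

namespace RootLeafU

variable {V : Type*} {E : Type*} [Fintype E] [DecidableEq E] {R : Type*} [CommRing R]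

/-- A state of the seven connections `(u↔a₂, a₂↔o, u↔o, a₂↔c, u↔c, a₂↔b, u↔b)`. -/
abbrev B7 := Bool × Bool × Bool × Bool × Bool × Bool × Bool

section Cells

variable [Fintype V] [DecidableEq V] (ends : E → Sym2 V) (o a₂ c b u : V)

/-- The state vector of a configuration. -/
def stateVec (ω : Config E) : B7 :=
  (decide (Conn ends ω u a₂), decide (Conn ends ω a₂ o), decide (Conn ends ω u o),
    decide (Conn ends ω a₂ c), decide (Conn ends ω u c), decide (Conn ends ω a₂ b),
    decide (Conn ends ω u b))

/-- The cell of a state: the configurations with that state vector. -/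
def cell (v : B7) : Set (Config E) := {ω | stateVec ends o a₂ c b u ω = v}

/-- The 35 consistent states. -/
def consistent : Finset B7 :=
  {(false, false, false, false, false, false, false), (false, false, false, false, false, false, true), (false, false, false, false, false, true, false), (false, false, false, false, true, false, false), (false, false, false, false, true, false, true), (false, false, false, false, true, true, false), (false, false, false, true, false, false, false), (false, false, false, true, false, false, true), (false, false, false, true, false, true, false), (false, false, true, false, false, false, false), (false, false, true, false, false, false, true), (false, false, true, false, false, true, false), (false, false, true, false, true, false, false), (false, false, true, false, true, false, true), (false, false, true, false, true, true, false), (false, false, true, true, false, false, false), (false, false, true, true, false, false, true), (false, false, true, true, false, true, false), (false, true, false, false, false, false, false), (false, true, false, false, false, false, true), (false, true, false, false, false, true, false), (false, true, false, false, true, false, false), (false, true, false, false, true, false, true), (false, true, false, false, true, true, false), (false, true, false, true, false, false, false), (false, true, false, true, false, false, true), (false, true, false, true, false, true, false), (true, false, false, false, false, false, false), (true, false, false, false, false, true, true), (true, false, false, true, true, false, false), (true, false, false, true, true, true, true), (true, true, true, false, false, false, false), (true, true, true, false, false, true, true), (true, true, true, true, true, false, false), (true, true, true, true, true, true, true)}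

omit [DecidableEq E] in
/-- Every configuration has a consistent state. -/
lemma stateVec_mem_consistent (ω : Config E) : stateVec ends o a₂ c b u ω ∈ consistent := by
  have to1 : Conn ends ω u a₂ → Conn ends ω a₂ o → Conn ends ω u o := fun h1 h2 => conn_trans h1 h2
  have to2 : Conn ends ω u a₂ → Conn ends ω u o → Conn ends ω a₂ o :=
    fun h1 h2 => conn_trans (conn_symm h1) h2
  have to3 : Conn ends ω a₂ o → Conn ends ω u o → Conn ends ω u a₂ :=
    fun h1 h2 => conn_trans h2 (conn_symm h1)
  have tc1 : Conn ends ω u a₂ → Conn ends ω a₂ c → Conn ends ω u c := fun h1 h2 => conn_trans h1 h2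
  have tc2 : Conn ends ω u a₂ → Conn ends ω u c → Conn ends ω a₂ c :=
    fun h1 h2 => conn_trans (conn_symm h1) h2
  have tc3 : Conn ends ω a₂ c → Conn ends ω u c → Conn ends ω u a₂ :=
    fun h1 h2 => conn_trans h2 (conn_symm h1)
  have tb1 : Conn ends ω u a₂ → Conn ends ω a₂ b → Conn ends ω u b := fun h1 h2 => conn_trans h1 h2
  have tb2 : Conn ends ω u a₂ → Conn ends ω u b → Conn ends ω a₂ b :=
    fun h1 h2 => conn_trans (conn_symm h1) h2
  have tb3 : Conn ends ω a₂ b → Conn ends ω u b → Conn ends ω u a₂ :=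
    fun h1 h2 => conn_trans h2 (conn_symm h1)
  simp only [stateVec, consistent, Finset.mem_insert, Finset.mem_singleton, Prod.mk.injEq]
  by_cases c1 : Conn ends ω u a₂ <;> by_cases c2 : Conn ends ω a₂ o <;>
    by_cases c3 : Conn ends ω u o <;> by_cases c4 : Conn ends ω a₂ c <;>
    by_cases c5 : Conn ends ω u c <;> by_cases c6 : Conn ends ω a₂ b <;>
    by_cases c7 : Conn ends ω u b <;> simp_all

omit [DecidableEq E] in
/-- Distinct cells are disjoint. -/
lemma disjoint_cell {v w : B7} (hvw : v ≠ w) :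
    Disjoint (cell ends o a₂ c b u v) (cell ends o a₂ c b u w) := by
  rw [Set.disjoint_left]
  intro ω hv hw
  exact hvw (hv.symm.trans hw)

variable (p : E → R)

/-- **Cell decomposition**: an event whose membership is a Boolean function `φ` of the state
vector has probability the sum of its consistent cells. -/
theorem prob_eq_sum_cells (M : Set (Config E)) (φ : B7 → Bool)
    (hM : ∀ ω, ω ∈ M ↔ φ (stateVec ends o a₂ c b u ω) = true) :
    prob p M = ∑ v ∈ consistent.filter (fun v => φ v = true), prob p (cell ends o a₂ c b u v) := by
  have hMeq : M = ⋃ v ∈ consistent.filter (fun v => φ v = true), cell ends o a₂ c b u v := by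
    ext ω
    simp only [Set.mem_iUnion, Finset.mem_filter, exists_prop, cell, Set.mem_setOf_eq]
    constructor
    · intro h
      exact ⟨_, ⟨stateVec_mem_consistent ends o a₂ c b u ω, (hM ω).1 h⟩, rfl⟩
    · rintro ⟨v, ⟨_, hφ⟩, hv⟩
      exact (hM ω).2 (hv ▸ hφ)
  rw [hMeq, RootLeafO.prob_biUnion]
  intro v _ w _ hvw
  exact disjoint_cell ends o a₂ c b u hvw

end Cells

end RootLeafU

end Summit.Ventures.PercRepro2
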